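import Literature.AlgebraicGeometry.Frobenioids.Thm42Sub
import Literature.AlgebraicGeometry.Frobenioids.Thm49FunctorialPullbacks
import Literature.AlgebraicGeometry.Frobenioids.BiratUnitsPullback
import HarnessLib

/-!
# [FrdI] Theorem 4.9, sub-node T49-L05 `PerfectStrictlyRationalWLOG`: "we may assume that `A` is strictly
# rational" — the transport of the LEFT-hand property along a pull-back morphism — PROVED

Mochizuki, *The geometry of Frobenioids I: the general theory*, Kyushu J. Math. **62** (2008) 293–400,
§4, proof of Theorem 4.9, kurims text p. 89 ll. 38–46 [cite: MochizukiFrdI2008, Thm. 4.9 p.89]: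

> "To prove that the right-hand and left-hand isomorphisms of Theorem 4.2, (iii), coincide for all
> universally Div-Frobenius-trivial objects, we reason as follows. First of all, by passing to perfections
> [cf. Theorem 3.4, (iii)], we may assume without loss of generality that `C₁`, `C₂` are of perfect type
> [cf. also Proposition 5.5, (iii), below]. Let `A` be a universally Div-Frobenius-trivial object of `C_i`
> [where `i = 1, 2`]. Since the right-hand and left-hand isomorphisms of Theorem 4.2, (iii), are clearly
> compatible with pull-back morphisms [cf. Proposition 1.11, (v); the proof of Theorem 4.2, (iii)], and `Ψ`
> preserves pull-back morphisms [cf. Theorem 3.4, (iii)], it follows that we may assume without loss of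
> generality that `A` is strictly rational."

PROOF-ONLY companion (seat abc-iut-w4-d109, L1-lead R91 (3)) of the S5 sub-DAG row T49-L05, whose named
statement `FrdI.T49.PerfectStrictlyRationalWLOG` is typed by seat abc-iut-w5-d021 in `Thm49SubII.lean` (v2;
row text `staging/L1/w5-d021/Thm49RowsL01L05.snippet.lean`, following seat abc-iut-w4-d105's analysis that
the transfer must be stated for the GLOBAL objectwise isomorphisms, a prime of `Φ₁(A)` need not pull back to
a prime of `Φ₁(A′)`). The theorem `FrdI.T49.leftHand_of_leftHand_of_isPullbackMorphism` below has EXACTLY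
the binders of that `def` (so the slot closer is the one-liner `fun F₁ F₂ Ψ => leftHand_of_…`): in the
`T42.Setting` (perfect + isotropic type — "after passing to the perfections"), for a pull-back morphism
`ψ : A′ → A`, isomorphisms of monoids `m′ : Φ₁(A′) ≃ Φ₂(Ψ A′)`, `m : Φ₁(A) ≃ Φ₂(Ψ A)` with the RIGHT-hand
property (they compute `Div(Ψ θ)` on pre-steps `θ` out of `A′`, `A`), the LEFT-hand property of `m′` at `A′`
implies the left-hand property of `m` at `A`. Route (print's "compatible with pull-back morphisms … `Ψ`
preserves pull-back morphisms"): pull the co-angular pre-step `χ : B → A` back along `ψ` (Prop. 1.11 (v):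
`PreFrobenioid.exists_preStep_pullback_square`, a square `α ≫ ψ = l ≫ χ` with `α : W → A′` a co-angular
pre-step and `l : W → B` a pull-back morphism; `Div α = Base(l)^* Div χ`, seat abc-iut-w4-d035's
`div_eq_pull_div_of_pullback_square`); the right-hand properties make `m′`, `m` natural along `ψ`
(`FrdI.T49.rightHand_natural_of_isPullbackMorphism`, the two-object form of abc-iut-w4-d035's
`pull_natural_of_isPullbackMorphism`); apply the left-hand property of `m′` to `(α, Base(ψ)^* y)`; map the
square by `Ψ` and cancel `Base(Ψ l)^*`, which is injective (Def. 1.1 (ii)(a), `IsMonoidOn.isCharInjective`).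
No new definitions; nothing of [FrdI] restated; nothing here bears on [IUTchIII] Cor. 3.12.
-/

namespace Literature.AlgebraicGeometry.Frobenioids

open CategoryTheory Opposite

namespace FrdI.T49

universe w v v' u u'

variable {D₁ : Type u} [Category.{v} D₁] {Φ₁ : D₁ᵒᵖ ⥤ CommMonCat.{w}} {C₁ : Type u'} [Category.{v'} C₁]
  {D₂ : Type u} [Category.{v} D₂] {Φ₂ : D₂ᵒᵖ ⥤ CommMonCat.{w}} {C₂ : Type u'} [Category.{v'} C₂]
  {F₁ : C₁ ⥤ ElemFrobenioid Φ₁} {F₂ : C₂ ⥤ ElemFrobenioid Φ₂} {Ψ : C₁ ≌ C₂}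

/-- **"the right-hand … isomorphisms … are clearly compatible with pull-back morphisms [cf. Proposition 1.11,
(v)] and `Ψ` preserves pull-back morphisms"** (p. 89 ll. 42–45), two-object form: if `m′ : Φ₁(A′) → Φ₂(Ψ A′)`
and `m : Φ₁(A) → Φ₂(Ψ A)` compute `Div(Ψ θ)` on the co-angular pre-steps `θ` out of `A′`, resp. `A`, then for a
pull-back morphism `ψ : A′ → A` one has `m′(Base(ψ)^* y) = Base(Ψ ψ)^* m(y)` — by "pulling back pre-steps"
(a square `α ≫ ψ′ = ψ ≫ β` of Prop. 1.11 (v) with prescribed zero divisors, Def. 1.3 (iii)(d)).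
[cite: MochizukiFrdI2008, Thm. 4.9 p.89] -/
theorem rightHand_natural_of_isPullbackMorphism (hF₁ : PreFrobenioid.IsFrobenioid F₁)
    (hF₂ : PreFrobenioid.IsFrobenioid F₂)
    (hpb : ∀ ⦃X Y : C₁⦄ (φ : X ⟶ Y),
      PreFrobenioid.IsPullbackMorphism F₁ φ → PreFrobenioid.IsPullbackMorphism F₂ (Ψ.functor.map φ))
    {A' A : C₁} (ψ : A' ⟶ A) (hψ : PreFrobenioid.IsPullbackMorphism F₁ ψ)
    (m' : Φ₁.obj (op (PreFrobenioid.baseObj F₁ A')) → Φ₂.obj (op (PreFrobenioid.baseObj F₂ (Ψ.functor.obj A'))))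
    (m : Φ₁.obj (op (PreFrobenioid.baseObj F₁ A)) → Φ₂.obj (op (PreFrobenioid.baseObj F₂ (Ψ.functor.obj A))))
    (hm' : ∀ ⦃B' : C₁⦄ (θ : A' ⟶ B'), PreFrobenioid.IsCoAngularPreStep F₁ θ →
      m' (PreFrobenioid.Div F₁ θ) = PreFrobenioid.Div F₂ (Ψ.functor.map θ))
    (hm : ∀ ⦃B : C₁⦄ (φ : A ⟶ B), PreFrobenioid.IsCoAngularPreStep F₁ φ →
      m (PreFrobenioid.Div F₁ φ) = PreFrobenioid.Div F₂ (Ψ.functor.map φ))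
    (y : Φ₁.obj (op (PreFrobenioid.baseObj F₁ A))) :
    m' (pull Φ₁ (PreFrobenioid.Base F₁ ψ) y) = pull Φ₂ (PreFrobenioid.Base F₂ (Ψ.functor.map ψ)) (m y) := by
  -- pre-steps with the prescribed zero divisors `y` (out of `A`) and `Base(ψ)^* y` (out of `A′`)
  obtain ⟨Y, β, hβ, hβy⟩ := hF₁.iii_d_under_surj A y
  obtain ⟨X, α, hα, hαy⟩ := hF₁.iii_d_under_surj A' (pull Φ₁ (PreFrobenioid.Base F₁ ψ) y)
  -- "pulling back pre-steps" (Prop. 1.11 (v)): a square `α ≫ ψ′ = ψ ≫ β` with `ψ′` a pull-back morphism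
  obtain ⟨ψ', hψ', hsq⟩ :=
    PreFrobenioid.exists_pullback_square_under hF₁ hψ α β hα hβ (by rw [hαy, hβy])
  have hsq₂ : Ψ.functor.map α ≫ Ψ.functor.map ψ' = Ψ.functor.map ψ ≫ Ψ.functor.map β := by
    rw [← Ψ.functor.map_comp, hsq, Ψ.functor.map_comp]
  rw [← hαy, ← hβy, hm' α hα, hm β hβ]
  exact PreFrobenioid.div_eq_pull_div_of_pullback_square hF₂ (hpb ψ hψ) (hpb ψ' hψ') hsq₂

/-- **T49-L05 `PerfectStrictlyRationalWLOG` — "we may assume without loss of generality that `A` is strictly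
rational"** (p. 89 ll. 38–46), in EXACTLY the binders of seat abc-iut-w5-d021's typed row: in the setting of
the proof of Thm. 4.2 (perfect and isotropic type, `Φ_i` perf-factorial, the Thm. 3.4 (ii)(iii) transports),
for a pull-back morphism `ψ : A′ → A` and isomorphisms of monoids `m′ : Φ₁(A′) ≃ Φ₂(Ψ A′)`,
`m : Φ₁(A) ≃ Φ₂(Ψ A)` having the RIGHT-hand property (on pre-steps out of `A′`, resp. `A`), the LEFT-hand
property of `m′` at `A′` ("`Base(Ψ χ)^* (m′ y) = Div(Ψ χ)` whenever `Base(χ)^* y = Div χ`, for co-angular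
pre-steps `χ` into `A′`") implies the left-hand property of `m` at `A`. Hence right = left at a strictly
rational `A′` transfers to every rational `A` (Def. 4.5 (ii): a pull-back morphism `A′ → A` exists).
[cite: MochizukiFrdI2008, Thm. 4.9 p.89] -/
theorem leftHand_of_leftHand_of_isPullbackMorphism (F₁ : C₁ ⥤ ElemFrobenioid Φ₁)
    (F₂ : C₂ ⥤ ElemFrobenioid Φ₂) (Ψ : C₁ ≌ C₂) (S : T42.Setting F₁ F₂ Ψ)
    {A' A : C₁} (ψ : A' ⟶ A) (hψ : PreFrobenioid.IsPullbackMorphism F₁ ψ)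
    (m' : Φ₁.obj (op (PreFrobenioid.baseObj F₁ A')) ≃* Φ₂.obj (op (PreFrobenioid.baseObj F₂ (Ψ.functor.obj A'))))
    (m : Φ₁.obj (op (PreFrobenioid.baseObj F₁ A)) ≃* Φ₂.obj (op (PreFrobenioid.baseObj F₂ (Ψ.functor.obj A))))
    (hm' : ∀ ⦃B' : C₁⦄ (θ : A' ⟶ B'), PreFrobenioid.IsPreStep F₁ θ →
      m' (PreFrobenioid.Div F₁ θ) = PreFrobenioid.Div F₂ (Ψ.functor.map θ))
    (hm : ∀ ⦃B : C₁⦄ (φ : A ⟶ B), PreFrobenioid.IsPreStep F₁ φ →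
      m (PreFrobenioid.Div F₁ φ) = PreFrobenioid.Div F₂ (Ψ.functor.map φ))
    (hleft' : ∀ ⦃B' : C₁⦄ (χ : B' ⟶ A'), PreFrobenioid.IsCoAngularPreStep F₁ χ →
      ∀ y : Φ₁.obj (op (PreFrobenioid.baseObj F₁ A')),
        pull Φ₁ (PreFrobenioid.Base F₁ χ) y = PreFrobenioid.Div F₁ χ →
          pull Φ₂ (PreFrobenioid.Base F₂ (Ψ.functor.map χ)) (m' y) = PreFrobenioid.Div F₂ (Ψ.functor.map χ))
    ⦃B : C₁⦄ (χ : B ⟶ A) (hχ : PreFrobenioid.IsCoAngularPreStep F₁ χ)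
    (y : Φ₁.obj (op (PreFrobenioid.baseObj F₁ A)))
    (hy : pull Φ₁ (PreFrobenioid.Base F₁ χ) y = PreFrobenioid.Div F₁ χ) :
    pull Φ₂ (PreFrobenioid.Base F₂ (Ψ.functor.map χ)) (m y) = PreFrobenioid.Div F₂ (Ψ.functor.map χ) := by
  have hF₁ := S.isFrobenioid₁
  have hF₂ := S.isFrobenioid₂
  -- pull `χ` back along `ψ` (Prop. 1.11 (v)): `α ≫ ψ = l ≫ χ`, `α` a co-angular pre-step into `A′`, `l` a
  -- pull-back morphism
  obtain ⟨W, α, l, hα, hl, hsq⟩ :=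
    PreFrobenioid.exists_preStep_pullback_square hF₁ S.isotropic₁ ψ hψ χ hχ
  -- zero divisors in the square: `Div α = Base(l)^* Div χ`
  have hdivα : PreFrobenioid.Div F₁ α = pull Φ₁ (PreFrobenioid.Base F₁ l) (PreFrobenioid.Div F₁ χ) :=
    PreFrobenioid.div_eq_pull_div_of_pullback_square hF₁ hl hψ hsq
  -- the left-hand hypothesis at `A′` applies to `(α, Base(ψ)^* y)`
  have hy' : pull Φ₁ (PreFrobenioid.Base F₁ α) (pull Φ₁ (PreFrobenioid.Base F₁ ψ) y) =
      PreFrobenioid.Div F₁ α := by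
    rw [← pull_comp, ← PreFrobenioid.base_comp, hsq, PreFrobenioid.base_comp, pull_comp, hy, hdivα]
  have h1 := hleft' α hα _ hy'
  -- naturality of the right-hand maps along `ψ`
  have hnat : m' (pull Φ₁ (PreFrobenioid.Base F₁ ψ) y) =
      pull Φ₂ (PreFrobenioid.Base F₂ (Ψ.functor.map ψ)) (m y) :=
    rightHand_natural_of_isPullbackMorphism hF₁ hF₂ S.pullback_map ψ hψ m' m
      (fun _ θ hθ => hm' θ hθ.2) (fun _ φ hφ => hm φ hφ.2) y
  rw [hnat, ← pull_comp, ← PreFrobenioid.base_comp, ← Ψ.functor.map_comp, hsq, Ψ.functor.map_comp,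
    PreFrobenioid.base_comp, pull_comp] at h1
  -- the square in `C₂`: `Div(Ψ α) = Base(Ψ l)^* Div(Ψ χ)`
  have hsq₂ : Ψ.functor.map α ≫ Ψ.functor.map ψ = Ψ.functor.map l ≫ Ψ.functor.map χ := by
    rw [← Ψ.functor.map_comp, hsq, Ψ.functor.map_comp]
  have hdivα₂ : PreFrobenioid.Div F₂ (Ψ.functor.map α) =
      pull Φ₂ (PreFrobenioid.Base F₂ (Ψ.functor.map l)) (PreFrobenioid.Div F₂ (Ψ.functor.map χ)) :=
    PreFrobenioid.div_eq_pull_div_of_pullback_square hF₂ (S.pullback_map l hl) (S.pullback_map ψ hψ) hsq₂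
  rw [hdivα₂] at h1
  -- cancel `Base(Ψ l)^*` (Def. 1.1 (ii)(a): pull-backs of the divisor monoid are injective)
  exact (hF₂.isPreFrobenioid.isMonoidOn.isCharInjective
    (PreFrobenioid.Base F₂ (Ψ.functor.map l))).1 h1

end FrdI.T49

end Literature.AlgebraicGeometry.Frobenioids
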